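import Summits.Ventures.GridStability.Models.InverterNetworkVoltageLinearisation

/-!
# GridStability/Models/InverterNetworkVoltagePH — the port-Hamiltonian factorisation `J(x) = (𝒥 − ℛ(x))·𝒬(x)` of the droop-microgrid Jacobian WITH voltage dynamics (rung G3.b small-signal lane, solver-free shape)

Cell `gridfusion` (LADDER-GRIDFUSION, APEX LINE rung G3.b «droop microgrid with Q–V voltage dynamics»;
seat gridfusion-model-8 (g0); brief = gridfusion-lead 2026-08-27T08:25:47Z (i), second half). Sibling of
`Models/InverterNetworkVoltageLinearisation.lean` (the `3n × 3n` Jacobian `jacMatrix (θ, V)` of model N1,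
`hasFDerivAt_field`). For a LOSSLESS network without shunt conductance (`G = 0`, the hypothesis under which
`Models/InverterNetworkHamiltonian.lean` identifies N1 with lit-2's printed port-Hamiltonian model
[cite: ShinZavala2020, eqs. (9)–(13)]) the Jacobian FACTORS through the printed structure matrices:
* §1 `block3` — `3 × 3` block matrices on `Fin n ⊕ (Fin n ⊕ Fin n)` and their product rule `block3_mul`
  (plumbing; `jacMatrix` is a `block3` by `rfl`);
* §2 `phJ = [[0, Λ, 0], [−Λ, 0, 0], [0, 0, 0]]` (`Λ = diag(k_P/τ_P)`), `phR V = diag(0, k_P/τ_P², k_Q V/τ_Q)`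
  [cite: ShinZavala2020, eq. (12)], and `hessQ (θ, V) = [[∂P/∂θ, 0, ∂P/∂V], [0, diag(τ_P/k_P), 0],
  [diag(V)⁻¹∂Q/∂θ, 0, diag(V)⁻¹(∂Q/∂V + diag(k_Q)⁻¹)]]` — the block pattern of the Hessian `∇²H` of the
  Hamiltonian (10) at a REST point (where `Q^u_i − Q_i = V_i/k_Qi`, [cite: ShinZavala2020, eq. (11c)]);
  `phJ_transpose` (`𝒥ᵀ = −𝒥`), `phR_posSemidef` (`ℛ ⪰ 0` for `k_P ≥ 0`, `k_Q V ≥ 0`), `hessQ_transpose`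
  (`𝒬ᵀ = 𝒬` for `B` symmetric, `G = 0`, `V_i ≠ 0`);
* §3 `jacMatrix_eq_pH`: `jacMatrix (θ, V) = (phJ − phR V) * hessQ (θ, V)` — an ALGEBRAIC identity valid at
  every state with `V_i, k_Pi, τ_Pi, k_Qi ≠ 0` and `G = 0` (no rest-point hypothesis is needed for the
  factorisation itself; only the reading «`hessQ` = `∇²H`» is a rest-point statement, and that second-derivative
  fact is deliberately NOT proved here — the spectral argument never uses it).
Consequence (model-3's `re_eig_nonpos_of_pH`, `Models/PortHamiltonianSpectrum.lean`, hypotheses `𝒥ᵀ = −𝒥`,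
`ℛ ⪰ 0`, `𝒬 ≻ 0`): ONE exact certificate `hessQ x* ≻ 0` on the rotation quotient excludes open right-half-plane
modes of `jacMatrix x*` for ANY `n`, solver-free; a decay RATE comes from the point lane (row #51).
THREE COLUMNS. CERTIFIED (kernel, this file): algebra about the MODEL N1; no numbers. MODELLED: MV-6N + MV-6D,
lossless + no shunt conductance. VALIDATED: nothing. No sentence of this file says a converter or a microgrid
is stable.
-/

noncomputable section

open Real Matrix Finset

namespace Summit.Ventures.GridStability.Models

namespace DroopMicrogrid

variable {n : ℕ} (mg : DroopMicrogrid n)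

/-! ## §1 `3 × 3` block matrices on `Fin n ⊕ (Fin n ⊕ Fin n)` -/

/-- A `3 × 3` block matrix on the state index `Fin n ⊕ (Fin n ⊕ Fin n)` (angles, frequencies, voltages).
[folklore] -/
def block3 (A₁₁ A₁₂ A₁₃ A₂₁ A₂₂ A₂₃ A₃₁ A₃₂ A₃₃ : Matrix (Fin n) (Fin n) ℝ) :
    Matrix (Fin n ⊕ (Fin n ⊕ Fin n)) (Fin n ⊕ (Fin n ⊕ Fin n)) ℝ :=
  Matrix.fromBlocks A₁₁ (Matrix.fromCols A₁₂ A₁₃) (Matrix.fromRows A₂₁ A₃₁) (Matrix.fromBlocks A₂₂ A₂₃ A₃₂ A₃₃)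

/-- Block product rule. [folklore] -/
theorem block3_mul (A₁₁ A₁₂ A₁₃ A₂₁ A₂₂ A₂₃ A₃₁ A₃₂ A₃₃ B₁₁ B₁₂ B₁₃ B₂₁ B₂₂ B₂₃ B₃₁ B₃₂ B₃₃ :
    Matrix (Fin n) (Fin n) ℝ) :
    block3 A₁₁ A₁₂ A₁₃ A₂₁ A₂₂ A₂₃ A₃₁ A₃₂ A₃₃ * block3 B₁₁ B₁₂ B₁₃ B₂₁ B₂₂ B₂₃ B₃₁ B₃₂ B₃₃ =
      block3 (A₁₁ * B₁₁ + A₁₂ * B₂₁ + A₁₃ * B₃₁) (A₁₁ * B₁₂ + A₁₂ * B₂₂ + A₁₃ * B₃₂)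
        (A₁₁ * B₁₃ + A₁₂ * B₂₃ + A₁₃ * B₃₃)
        (A₂₁ * B₁₁ + A₂₂ * B₂₁ + A₂₃ * B₃₁) (A₂₁ * B₁₂ + A₂₂ * B₂₂ + A₂₃ * B₃₂)
        (A₂₁ * B₁₃ + A₂₂ * B₂₃ + A₂₃ * B₃₃)
        (A₃₁ * B₁₁ + A₃₂ * B₂₁ + A₃₃ * B₃₁) (A₃₁ * B₁₂ + A₃₂ * B₂₂ + A₃₃ * B₃₂)
        (A₃₁ * B₁₃ + A₃₂ * B₂₃ + A₃₃ * B₃₃) := by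
  ext (i | i | i) (j | j | j) <;>
    simp [block3, Matrix.mul_apply, Matrix.add_apply, Fintype.sum_sum_type, Matrix.fromBlocks,
      Matrix.fromCols, Matrix.fromRows, add_assoc]

/-- Block difference. [folklore] -/
theorem block3_sub (A₁₁ A₁₂ A₁₃ A₂₁ A₂₂ A₂₃ A₃₁ A₃₂ A₃₃ B₁₁ B₁₂ B₁₃ B₂₁ B₂₂ B₂₃ B₃₁ B₃₂ B₃₃ :
    Matrix (Fin n) (Fin n) ℝ) :
    block3 A₁₁ A₁₂ A₁₃ A₂₁ A₂₂ A₂₃ A₃₁ A₃₂ A₃₃ - block3 B₁₁ B₁₂ B₁₃ B₂₁ B₂₂ B₂₃ B₃₁ B₃₂ B₃₃ =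
      block3 (A₁₁ - B₁₁) (A₁₂ - B₁₂) (A₁₃ - B₁₃) (A₂₁ - B₂₁) (A₂₂ - B₂₂) (A₂₃ - B₂₃) (A₃₁ - B₃₁)
        (A₃₂ - B₃₂) (A₃₃ - B₃₃) := by
  ext (i | i | i) (j | j | j) <;> simp [block3, Matrix.fromBlocks, Matrix.fromCols, Matrix.fromRows]

/-- Block transpose. [folklore] -/
theorem block3_transpose (A₁₁ A₁₂ A₁₃ A₂₁ A₂₂ A₂₃ A₃₁ A₃₂ A₃₃ : Matrix (Fin n) (Fin n) ℝ) :
    (block3 A₁₁ A₁₂ A₁₃ A₂₁ A₂₂ A₂₃ A₃₁ A₃₂ A₃₃)ᵀ =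
      block3 A₁₁ᵀ A₂₁ᵀ A₃₁ᵀ A₁₂ᵀ A₂₂ᵀ A₃₂ᵀ A₁₃ᵀ A₂₃ᵀ A₃₃ᵀ := by
  ext (i | i | i) (j | j | j) <;> simp [block3, Matrix.fromBlocks, Matrix.fromCols, Matrix.fromRows]

/-- Block negation. [folklore] -/
theorem block3_neg (A₁₁ A₁₂ A₁₃ A₂₁ A₂₂ A₂₃ A₃₁ A₃₂ A₃₃ : Matrix (Fin n) (Fin n) ℝ) :
    -block3 A₁₁ A₁₂ A₁₃ A₂₁ A₂₂ A₂₃ A₃₁ A₃₂ A₃₃ =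
      block3 (-A₁₁) (-A₁₂) (-A₁₃) (-A₂₁) (-A₂₂) (-A₂₃) (-A₃₁) (-A₃₂) (-A₃₃) := by
  ext (i | i | i) (j | j | j) <;> simp [block3, Matrix.fromBlocks, Matrix.fromCols, Matrix.fromRows]

/-- Blocks are determined by the block matrix. [folklore] -/
theorem block3_inj {A₁₁ A₁₂ A₁₃ A₂₁ A₂₂ A₂₃ A₃₁ A₃₂ A₃₃ B₁₁ B₁₂ B₁₃ B₂₁ B₂₂ B₂₃ B₃₁ B₃₂ B₃₃ :
    Matrix (Fin n) (Fin n) ℝ}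
    (h₁₁ : A₁₁ = B₁₁) (h₁₂ : A₁₂ = B₁₂) (h₁₃ : A₁₃ = B₁₃) (h₂₁ : A₂₁ = B₂₁) (h₂₂ : A₂₂ = B₂₂)
    (h₂₃ : A₂₃ = B₂₃) (h₃₁ : A₃₁ = B₃₁) (h₃₂ : A₃₂ = B₃₂) (h₃₃ : A₃₃ = B₃₃) :
    block3 A₁₁ A₁₂ A₁₃ A₂₁ A₂₂ A₂₃ A₃₁ A₃₂ A₃₃ = block3 B₁₁ B₁₂ B₁₃ B₂₁ B₂₂ B₂₃ B₃₁ B₃₂ B₃₃ := by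
  subst h₁₁ h₁₂ h₁₃ h₂₁ h₂₂ h₂₃ h₃₁ h₃₂ h₃₃; rfl

/-- `jacMatrix` in `block3` form (definitional). [folklore] -/
theorem jacMatrix_eq_block3 (θ V : Fin n → ℝ) :
    mg.jacMatrix θ V = block3 0 1 0
      (-(Matrix.diagonal mg.ΛP * mg.Pθ θ V)) (-Matrix.diagonal fun i => 1 / mg.τP i)
      (-(Matrix.diagonal mg.ΛP * mg.PV θ V))
      (-(Matrix.diagonal mg.ΛQ * mg.Qθ θ V)) 0
      (-(Matrix.diagonal (fun i => 1 / mg.τQ i) * (1 + Matrix.diagonal mg.kQ * mg.QV θ V))) := rfl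

/-! ## §2 The printed structure matrices and the Hessian pattern -/

/-- The printed interconnection matrix `𝒥 = [[0, Λ, 0], [−Λ, 0, 0], [0, 0, 0]]`, `Λ = diag(k_P/τ_P)`.
[cite: ShinZavala2020, eq. (12)] -/
def phJ : Matrix (Fin n ⊕ (Fin n ⊕ Fin n)) (Fin n ⊕ (Fin n ⊕ Fin n)) ℝ :=
  block3 0 (Matrix.diagonal mg.ΛP) 0 (-Matrix.diagonal mg.ΛP) 0 0 0 0 0

/-- The printed dissipation matrix `ℛ(x) = diag(0, k_P/τ_P², k_Q V/τ_Q)`. [cite: ShinZavala2020, eq. (12)] -/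
def phR (V : Fin n → ℝ) : Matrix (Fin n ⊕ (Fin n ⊕ Fin n)) (Fin n ⊕ (Fin n ⊕ Fin n)) ℝ :=
  block3 0 0 0 0 (Matrix.diagonal fun i => mg.kP i / mg.τP i ^ 2) 0 0 0
    (Matrix.diagonal fun i => mg.kQ i * V i / mg.τQ i)

/-- **The Hessian pattern `𝒬(θ, V)` of the Hamiltonian (10)** (algebraic definition): blocks
`[[∂P/∂θ, 0, ∂P/∂V], [0, diag(τ_P/k_P), 0], [diag(V)⁻¹∂Q/∂θ, 0, diag(V)⁻¹(∂Q/∂V + diag(k_Q)⁻¹)]]` — the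
`VV` entry is `∂/∂V` of (11c) with the rest-point relation `Q^u_i − Q_i = V_i/k_Qi` substituted.
[cite: ShinZavala2020, eqs. (10)–(11)] -/
def hessQ (θ V : Fin n → ℝ) : Matrix (Fin n ⊕ (Fin n ⊕ Fin n)) (Fin n ⊕ (Fin n ⊕ Fin n)) ℝ :=
  block3 (mg.Pθ θ V) 0 (mg.PV θ V) 0 (Matrix.diagonal fun i => mg.τP i / mg.kP i) 0
    (Matrix.diagonal (fun i => (V i)⁻¹) * mg.Qθ θ V) 0
    (Matrix.diagonal (fun i => (V i)⁻¹) * (mg.QV θ V + Matrix.diagonal fun i => (mg.kQ i)⁻¹))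

/-- **`𝒥` is skew**: `𝒥ᵀ = −𝒥`. [folklore] -/
theorem phJ_transpose : (mg.phJ)ᵀ = -mg.phJ := by
  rw [phJ, block3_transpose, block3_neg]
  exact block3_inj (by simp) (by simp) (by simp) (by simp) (by simp) (by simp) (by simp) (by simp) (by simp)

/-- `ℛ(x)` is the diagonal matrix `diag(0, k_P/τ_P², k_Q V/τ_Q)`. [folklore] -/
theorem phR_eq_diagonal (V : Fin n → ℝ) : mg.phR V = Matrix.diagonal (Sum.elim (fun _ => (0 : ℝ))
    (Sum.elim (fun i => mg.kP i / mg.τP i ^ 2) (fun i => mg.kQ i * V i / mg.τQ i))) := by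
  ext (i | i | i) (j | j | j) <;>
    simp [phR, block3, Matrix.fromBlocks, Matrix.fromCols, Matrix.fromRows, Matrix.diagonal_apply]

/-- **`ℛ(x) ⪰ 0`** when `k_Pi/τ_Pi² ≥ 0` and `k_Qi V_i/τ_Qi ≥ 0` (positive gains, time constants and
voltages). [folklore] -/
theorem phR_posSemidef (V : Fin n → ℝ) (hP : ∀ i, 0 ≤ mg.kP i / mg.τP i ^ 2)
    (hQ : ∀ i, 0 ≤ mg.kQ i * V i / mg.τQ i) : (mg.phR V).PosSemidef := by
  rw [phR_eq_diagonal]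
  refine Matrix.PosSemidef.diagonal fun k => ?_
  rcases k with i | i | i
  · simp
  · simpa using hP i
  · simpa using hQ i

/-- `∂P/∂θ` is symmetric for a reciprocal lossless network (`B` symmetric, `G = 0`). [folklore] -/
theorem Pθ_transpose (hG : ∀ i j, mg.G i j = 0) (hB : ∀ i j, mg.B i j = mg.B j i) (θ V : Fin n → ℝ) :
    (mg.Pθ θ V)ᵀ = mg.Pθ θ V := by
  have ha : ∀ i j, mg.aP θ V j i = mg.aP θ V i j := by
    intro i j
    simp only [aP, dgP, hG, hB i j, zero_mul, neg_zero, zero_add]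
    rw [← neg_sub (θ i) (θ j), cos_neg]
    ring
  ext i j
  simp only [Pθ, Matrix.transpose_apply, Matrix.sub_apply, Matrix.diagonal_apply, ha i j]
  by_cases h : i = j
  · subst h; simp
  · simp [h, Ne.symm h]

/-- With `G = 0`: `(diag(V)⁻¹ ∂Q/∂θ)ᵀ = ∂P/∂V` (`V_i ≠ 0`, `B` symmetric) — the mixed blocks of `𝒬` agree.
[folklore] -/
theorem Qθ_scaled_transpose (hG : ∀ i j, mg.G i j = 0) (hB : ∀ i j, mg.B i j = mg.B j i) (θ V : Fin n → ℝ)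
    (hV : ∀ i, V i ≠ 0) : (Matrix.diagonal (fun i => (V i)⁻¹) * mg.Qθ θ V)ᵀ = mg.PV θ V := by
  ext i j
  simp only [Matrix.transpose_apply, Matrix.diagonal_mul, Qθ, PV, Matrix.sub_apply, Matrix.add_apply,
    Matrix.diagonal_apply, Matrix.of_apply, aQ, gP, hG, zero_mul, zero_add]
  by_cases h : j = i
  · subst h
    have hj := hV j
    simp only [if_true, sub_self, sin_zero, mul_zero, add_zero, sub_zero, Finset.mul_sum]
    refine Finset.sum_congr rfl fun x _ => ?_
    field_simp
  · have h' : ¬ i = j := fun e => h e.symm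
    have hj := hV j
    simp only [h, h', if_false, zero_sub, zero_add, hB j i]
    rw [← neg_sub (θ i) (θ j), sin_neg]
    field_simp

/-- With `G = 0`: `∂Q/∂V` scaled by `diag(V)⁻¹` is symmetric (`B` symmetric, `V_i ≠ 0`). [folklore] -/
theorem QV_scaled_transpose (hG : ∀ i j, mg.G i j = 0) (hB : ∀ i j, mg.B i j = mg.B j i) (θ V : Fin n → ℝ)
    (hV : ∀ i, V i ≠ 0) :
    (Matrix.diagonal (fun i => (V i)⁻¹) * (mg.QV θ V + Matrix.diagonal fun i => (mg.kQ i)⁻¹))ᵀ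
      = Matrix.diagonal (fun i => (V i)⁻¹) * (mg.QV θ V + Matrix.diagonal fun i => (mg.kQ i)⁻¹) := by
  ext i j
  simp only [Matrix.transpose_apply, Matrix.diagonal_mul, QV, Matrix.add_apply, Matrix.diagonal_apply,
    Matrix.of_apply, gQ, hG, zero_mul, zero_sub]
  by_cases h : j = i
  · subst h; rfl
  · have h' : ¬ i = j := fun e => h e.symm
    have hi := hV i
    have hj := hV j
    simp only [h, h', if_false, zero_add, add_zero, hB j i]
    rw [← neg_sub (θ i) (θ j), cos_neg]
    field_simp

/-- **`𝒬ᵀ = 𝒬`**: the Hessian pattern is symmetric for a reciprocal lossless network at positive voltages.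
[folklore] -/
theorem hessQ_transpose (hG : ∀ i j, mg.G i j = 0) (hB : ∀ i j, mg.B i j = mg.B j i) (θ V : Fin n → ℝ)
    (hV : ∀ i, V i ≠ 0) : (mg.hessQ θ V)ᵀ = mg.hessQ θ V := by
  rw [hessQ, block3_transpose]
  have h1 := mg.Pθ_transpose hG hB θ V
  have h2 := mg.Qθ_scaled_transpose hG hB θ V hV
  have h3 := mg.QV_scaled_transpose hG hB θ V hV
  have h2' : (mg.PV θ V)ᵀ = Matrix.diagonal (fun i => (V i)⁻¹) * mg.Qθ θ V := by
    rw [← h2, Matrix.transpose_transpose]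
  refine block3_inj h1 (by simp) h2 (by simp) (Matrix.diagonal_transpose _) (by simp) h2' (by simp) h3

/-! ## §3 The factorisation -/

/-- `𝒥 − ℛ(x)` in block form. [folklore] -/
theorem phJ_sub_phR (V : Fin n → ℝ) : mg.phJ - mg.phR V =
    block3 0 (Matrix.diagonal mg.ΛP) 0 (-Matrix.diagonal mg.ΛP) (-Matrix.diagonal fun i => mg.kP i / mg.τP i ^ 2)
      0 0 0 (-Matrix.diagonal fun i => mg.kQ i * V i / mg.τQ i) := by
  rw [phJ, phR, block3_sub]
  refine block3_inj (by simp) (by simp) (by simp) (by simp) (by simp) (by simp) (by simp) (by simp) (by simp)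

/-- **The port-Hamiltonian factorisation of the Jacobian**: `jacMatrix (θ, V) = (𝒥 − ℛ(V))·𝒬(θ, V)` whenever
`k_Pi, τ_Pi, k_Qi, V_i ≠ 0` (an algebraic identity at every such state; at a REST point of a `G = 0` network
`𝒬` is the Hessian pattern of the Hamiltonian (10), so this is the linearisation of `ẋ = (𝒥 − ℛ(x))∇H(x)`
[cite: ShinZavala2020, eqs. (11)–(12)]). With `phJ_transpose`, `phR_posSemidef`, `hessQ_transpose` this is
exactly the hypothesis shape of model-3's `re_eig_nonpos_of_pH`. MODELLED: MV-6N + MV-6D. [folklore] -/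
theorem jacMatrix_eq_pH (θ V : Fin n → ℝ) (hkP : ∀ i, mg.kP i ≠ 0) (hτP : ∀ i, mg.τP i ≠ 0)
    (hkQ : ∀ i, mg.kQ i ≠ 0) (hV : ∀ i, V i ≠ 0) :
    mg.jacMatrix θ V = (mg.phJ - mg.phR V) * mg.hessQ θ V := by
  rw [phJ_sub_phR, hessQ, block3_mul, jacMatrix_eq_block3]
  refine block3_inj ?_ ?_ ?_ ?_ ?_ ?_ ?_ ?_ ?_
  · simp
  · ext i j
    rcases eq_or_ne i j with rfl | hij
    · have h1 := hkP i
      have h2 := hτP i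
      simp [ΛP]
      field_simp
    · simp [hij]
  · simp
  · rw [Matrix.neg_mul, Matrix.neg_mul, Matrix.mul_zero, Matrix.zero_mul, add_zero, neg_zero, add_zero]
  · ext i j
    rcases eq_or_ne i j with rfl | hij
    · have h1 := hkP i
      have h2 := hτP i
      simp
      field_simp
    · simp [hij]
  · rw [Matrix.neg_mul, Matrix.neg_mul, Matrix.mul_zero, Matrix.zero_mul, add_zero, neg_zero, add_zero]
  · rw [Matrix.zero_mul, Matrix.zero_mul, zero_add, zero_add, Matrix.neg_mul, ← Matrix.mul_assoc,
      Matrix.diagonal_mul_diagonal]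
    congr 2
    ext i j
    rcases eq_or_ne i j with rfl | hij
    · have h3 := hV i
      simp [ΛQ]
      field_simp
    · simp [hij]
  · simp
  · rw [Matrix.zero_mul, Matrix.zero_mul, zero_add, zero_add, Matrix.neg_mul, ← Matrix.mul_assoc,
      Matrix.diagonal_mul_diagonal, Matrix.mul_add, Matrix.mul_add, Matrix.mul_one, Matrix.diagonal_mul_diagonal,
      ← Matrix.mul_assoc, Matrix.diagonal_mul_diagonal]
    have e1 : (fun i => 1 / mg.τQ i * mg.kQ i) = fun i => mg.kQ i * V i / mg.τQ i * (V i)⁻¹ := by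
      funext i
      have h3 := hV i
      field_simp
    have e2 : (fun i => mg.kQ i * V i / mg.τQ i * (V i)⁻¹ * (mg.kQ i)⁻¹) = fun i => 1 / mg.τQ i := by
      funext i
      have h3 := hV i
      have h4 := hkQ i
      field_simp
    rw [e1, e2, add_comm]

end DroopMicrogrid

end Summit.Ventures.GridStability.Models

end
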